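import Literature.Probability.RandomMatrix.ComplexGaussianNormSq
import HarnessLib

/-!
# The law of the scaled Beta–Gamma ratio `m·S₁/(S₁+S₂)`

Let `S₁ ∼ Gamma(n,1)` and `S₂ ∼ Gamma(p,1)` be independent. This file computes the law of
`m S₁/(S₁+S₂)` (`m` times a `Beta(n,p)` variable) on sets: by the change of variables
`x = m s/(s+t)` in the `t`-integral and Tonelli,

  `(Gamma(n,1) ⊗ Gamma(p,1)){(s,t) | m s/(s+t) ∈ E} = ∫_{(0,m) ∩ E} q(x) dx`   (`map_ratio_apply`)

with `q = ratioDensity n p m`, and for integer shapes `n, p ≥ 1` evaluates the remaining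
`s`-integral (a Gamma integral):

  `q(x) = Γ(n+p)/(Γ(n)Γ(p)) · x^{n−1} (m−x)^{p−1} / m^{n+p−1}`   on `(0,m)`   (`ratioDensity_eq`),

i.e. the `Beta(n,p)` density rescaled to `(0,m)`. It also records the Gamma moments
`𝔼 X^k = Γ(a+k)/Γ(a)` (`lintegral_rpow_mul_gammaPDF`). These are the inputs of the total-variation
comparison of `m S₁/(S₁+S₂)` with `Gamma(n,1)` (file `BetaGammaRatioTV`), the radial part of the
Diaconis–Freedman-type comparison between truncated uniform points on spheres and Gaussians.

## References

* P. Diaconis, D. Freedman, *A dozen de Finetti-style results in search of a theory*,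
  Ann. Inst. H. Poincaré Probab. Statist. 23 (1987) 397–423, §2 (Beta law of the squared norm of
  the first coordinates of a uniform point on a sphere; the real case).
-/

open MeasureTheory ProbabilityTheory Real Set
open scoped ENNReal NNReal

namespace Literature.Probability.Distributions

open Literature.Probability.RandomMatrix (measurable_gammaPDF gammaPDF_one_one)

/-! ### Gamma integrals and moments -/

/-- Integrals against `gammaPDF a 1` live on `(0, ∞)`. [folklore] -/
theorem lintegral_gammaPDF_mul_eq_setLIntegral_Ioi (a : ℝ) (F : ℝ → ℝ≥0∞) :
    ∫⁻ s, gammaPDF a 1 s * F s = ∫⁻ s in Ioi 0, gammaPDF a 1 s * F s := by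
  rw [← lintegral_add_compl _ measurableSet_Ici, compl_Ici]
  have h0 : ∫⁻ s in Iio 0, gammaPDF a 1 s * F s = 0 := by
    rw [setLIntegral_congr_fun measurableSet_Iio (fun s (hs : s < 0) => by
      rw [gammaPDF_of_neg hs, zero_mul]), lintegral_zero]
  rw [h0, add_zero, setLIntegral_congr Ioi_ae_eq_Ici]

/-- The Gamma integral with a rate, in `ℝ≥0∞` form: for `a, r > 0`,
`∫_{[0,∞)} x^{a−1} e^{−rx} dx = Γ(a)/r^a` (the `Gamma(a,r)` density has total mass one). [folklore] -/
theorem lintegral_Ici_rpow_mul_exp_neg_mul {a r : ℝ} (ha : 0 < a) (hr : 0 < r) :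
    ∫⁻ x in Ici (0:ℝ), ENNReal.ofReal (x ^ (a - 1) * Real.exp (-(r * x))) =
      ENNReal.ofReal (Real.Gamma a / r ^ a) := by
  have h1 := lintegral_gammaPDF_eq_one ha hr
  rw [← lintegral_add_compl _ measurableSet_Ici] at h1
  have h0 : ∫⁻ x in (Ici (0:ℝ))ᶜ, gammaPDF a r x = 0 := by
    rw [compl_Ici, setLIntegral_congr_fun measurableSet_Iio
      (fun x (hx : x < 0) => gammaPDF_of_neg hx), lintegral_zero]
  rw [h0, add_zero] at h1
  have hc : 0 < r ^ a / Real.Gamma a := div_pos (rpow_pos_of_pos hr a) (Real.Gamma_pos_of_pos ha)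
  have h2 : ∫⁻ x in Ici (0:ℝ), gammaPDF a r x =
      ENNReal.ofReal (r ^ a / Real.Gamma a) *
        ∫⁻ x in Ici (0:ℝ), ENNReal.ofReal (x ^ (a - 1) * Real.exp (-(r * x))) := by
    rw [← lintegral_const_mul _ (by fun_prop)]
    refine setLIntegral_congr_fun measurableSet_Ici fun x (hx : 0 ≤ x) => ?_
    rw [gammaPDF_of_nonneg hx, ← ENNReal.ofReal_mul hc.le]
    congr 1; ring
  rw [h2] at h1
  have h3 : ENNReal.ofReal (Real.Gamma a / r ^ a) * ENNReal.ofReal (r ^ a / Real.Gamma a) = 1 := by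
    rw [← ENNReal.ofReal_mul (by positivity), div_mul_div_comm, mul_comm (Real.Gamma a),
      div_self (by positivity), ENNReal.ofReal_one]
  calc ∫⁻ x in Ici (0:ℝ), ENNReal.ofReal (x ^ (a - 1) * Real.exp (-(r * x)))
      = (ENNReal.ofReal (Real.Gamma a / r ^ a) * ENNReal.ofReal (r ^ a / Real.Gamma a)) *
          ∫⁻ x in Ici (0:ℝ), ENNReal.ofReal (x ^ (a - 1) * Real.exp (-(r * x))) := by
        rw [h3, one_mul]
    _ = ENNReal.ofReal (Real.Gamma a / r ^ a) := by rw [mul_assoc, h1, mul_one]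

/-- `gammaPDF a 1 x · x^k = (Γ(a+k)/Γ(a)) · gammaPDF (a+k) 1 x` for `x > 0` (`k ≥ 0`). [folklore] -/
theorem gammaPDF_mul_rpow {a k : ℝ} (ha : 0 < a) (hk : 0 ≤ k) {x : ℝ} (hx : 0 < x) :
    gammaPDF a 1 x * ENNReal.ofReal (x ^ k) =
      ENNReal.ofReal (Real.Gamma (a + k) / Real.Gamma a) * gammaPDF (a + k) 1 x := by
  have hΓa := Real.Gamma_pos_of_pos ha
  have hΓak := Real.Gamma_pos_of_pos (by linarith : 0 < a + k)
  have hX : 0 ≤ 1 ^ a / Real.Gamma a * x ^ (a - 1) * Real.exp (-(1 * x)) := by positivity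
  have hY : 0 ≤ Real.Gamma (a + k) / Real.Gamma a := by positivity
  rw [gammaPDF_of_nonneg hx.le, gammaPDF_of_nonneg hx.le, ← ENNReal.ofReal_mul hX,
    ← ENNReal.ofReal_mul hY]
  congr 1
  rw [one_rpow, one_rpow, show a + k - 1 = (a - 1) + k by ring, Real.rpow_add hx]
  field_simp

/-- **Gamma moments**: `∫ gammaPDF a 1 x · x^k dx = Γ(a+k)/Γ(a)` (`a > 0`, `k ≥ 0`). [folklore] -/
theorem lintegral_gammaPDF_mul_rpow {a k : ℝ} (ha : 0 < a) (hk : 0 ≤ k) :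
    ∫⁻ x, gammaPDF a 1 x * ENNReal.ofReal (x ^ k) =
      ENNReal.ofReal (Real.Gamma (a + k) / Real.Gamma a) := by
  rw [lintegral_gammaPDF_mul_eq_setLIntegral_Ioi,
    setLIntegral_congr_fun measurableSet_Ioi (fun x (hx : 0 < x) => gammaPDF_mul_rpow ha hk hx),
    lintegral_const_mul _ (measurable_gammaPDF _ _)]
  have h1 : ∫⁻ x in Ioi 0, gammaPDF (a + k) 1 x = 1 := by
    have := lintegral_gammaPDF_mul_eq_setLIntegral_Ioi (a + k) (fun _ => 1)
    simp only [mul_one] at this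
    rw [← this, lintegral_gammaPDF_eq_one (by linarith) one_pos]
  rw [h1, mul_one]

/-- First moment: `∫ gammaPDF a 1 x · x dx = a`. [folklore] -/
theorem lintegral_gammaPDF_mul_id {a : ℝ} (ha : 0 < a) :
    ∫⁻ x, gammaPDF a 1 x * ENNReal.ofReal x = ENNReal.ofReal a := by
  have h := lintegral_gammaPDF_mul_rpow ha zero_le_one
  simp_rw [Real.rpow_one] at h
  rw [h, Real.Gamma_add_one ha.ne', mul_div_assoc, div_self (Real.Gamma_pos_of_pos ha).ne', mul_one]

/-- Second moment: `∫ gammaPDF a 1 x · x² dx = a(a+1)`. [folklore] -/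
theorem lintegral_gammaPDF_mul_sq {a : ℝ} (ha : 0 < a) :
    ∫⁻ x, gammaPDF a 1 x * ENNReal.ofReal (x ^ 2) = ENNReal.ofReal (a * (a + 1)) := by
  have h := lintegral_gammaPDF_mul_rpow ha (by norm_num : (0:ℝ) ≤ 2)
  have h2 : ∀ x : ℝ, x ^ (2:ℝ) = x ^ (2:ℕ) := fun x => by exact_mod_cast Real.rpow_natCast x 2
  simp_rw [h2] at h
  rw [h]
  congr 1
  have hΓ := (Real.Gamma_pos_of_pos ha).ne'
  rw [show a + 2 = (a + 1) + 1 by ring, Real.Gamma_add_one (by linarith), Real.Gamma_add_one ha.ne']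
  field_simp

/-- The `Gamma(n,1)` density for a positive integer shape, with a natural-number power:
`gammaPDF n 1 s = Γ(n)⁻¹ s^{n−1} e^{−s}` for `s ≥ 0`. [folklore] -/
theorem gammaPDF_natCast {n : ℕ} (hn : 1 ≤ n) {s : ℝ} (hs : 0 ≤ s) :
    gammaPDF n 1 s = ENNReal.ofReal ((Real.Gamma n)⁻¹ * s ^ (n - 1) * Real.exp (-s)) := by
  rw [gammaPDF_of_nonneg hs, one_rpow, one_mul, one_div]
  have : (n : ℝ) - 1 = ((n - 1 : ℕ) : ℝ) := by rw [Nat.cast_sub hn, Nat.cast_one]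
  rw [this, Real.rpow_natCast]

/-- The Gamma integral for a natural exponent: `∫_{(0,∞)} s^k e^{−rs} ds = Γ(k+1)/r^{k+1}`.
[folklore] -/
theorem lintegral_Ioi_pow_mul_exp_neg_mul (k : ℕ) {r : ℝ} (hr : 0 < r) :
    ∫⁻ s in Ioi (0:ℝ), ENNReal.ofReal (s ^ k * Real.exp (-(r * s))) =
      ENNReal.ofReal (Real.Gamma (k + 1) / r ^ (k + 1)) := by
  have h := lintegral_Ici_rpow_mul_exp_neg_mul (a := k + 1) (r := r) (by positivity) hr
  rw [setLIntegral_congr Ioi_ae_eq_Ici]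
  have h1 : ∀ s : ℝ, s ^ ((k : ℝ) + 1 - 1) = s ^ k := fun s => by
    rw [add_sub_cancel_right, Real.rpow_natCast]
  simp_rw [h1] at h
  rw [h]
  congr 2
  exact_mod_cast Real.rpow_natCast r (k + 1)

/-! ### The density of `m S₁/(S₁+S₂)` -/

section Density

/-- The inner change of variables: for `s, m > 0` and measurable `E`,
`Gamma(p,1){t | m s/(s+t) ∈ E} = ∫_{(0,m)} 1_E(x) · gammaPDF p 1 (s(m−x)/x) · (s m / x²) dx`
(substitute `t = s(m−x)/x`). [folklore] -/
theorem gammaMeasure_preimage_ratio (p : ℝ) {m s : ℝ} (hm : 0 < m) (hs : 0 < s)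
    {E : Set ℝ} (hE : MeasurableSet E) :
    gammaMeasure p 1 {t | m * s / (s + t) ∈ E} =
      ∫⁻ x in Ioo 0 m, E.indicator 1 x * (gammaPDF p 1 (s * (m - x) / x) *
        ENNReal.ofReal (s * m / x ^ 2)) := by
  have hφm : Measurable fun t : ℝ => m * s / (s + t) := by fun_prop
  have hEm : MeasurableSet {t : ℝ | m * s / (s + t) ∈ E} := hφm hE
  rw [gammaMeasure, withDensity_apply _ hEm]
  -- the density vanishes off `(0, ∞)`: reduce to `Ioi 0`
  have hsplit : ∫⁻ t in {t : ℝ | m * s / (s + t) ∈ E}, gammaPDF p 1 t =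
      ∫⁻ t in Ioi 0, ({t : ℝ | m * s / (s + t) ∈ E}).indicator (gammaPDF p 1) t := by
    rw [← lintegral_indicator hEm]
    have : ∀ t, ({t : ℝ | m * s / (s + t) ∈ E}).indicator (gammaPDF p 1) t =
        gammaPDF p 1 t * ({t : ℝ | m * s / (s + t) ∈ E}).indicator 1 t := fun t => by
      by_cases h : t ∈ {t : ℝ | m * s / (s + t) ∈ E}
      · rw [Set.indicator_of_mem h, Set.indicator_of_mem h, Pi.one_apply, mul_one]
      · rw [Set.indicator_of_notMem h, Set.indicator_of_notMem h, mul_zero]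
    simp_rw [this]
    exact lintegral_gammaPDF_mul_eq_setLIntegral_Ioi p _
  rw [hsplit]
  -- substitution `t = ψ x = s (m - x) / x` on `(0, m)`
  set ψ : ℝ → ℝ := fun x => s * (m - x) / x with hψ
  have himage : ψ '' Ioo 0 m = Ioi 0 := by
    ext t
    simp only [Set.mem_image, Set.mem_Ioo, Set.mem_Ioi, hψ]
    constructor
    · rintro ⟨x, ⟨hx0, hxm⟩, rfl⟩
      exact div_pos (mul_pos hs (by linarith)) hx0
    · intro ht
      have hst : 0 < s + t := by positivity
      refine ⟨m * s / (s + t), ⟨by positivity, ?_⟩, ?_⟩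
      · rw [div_lt_iff₀ hst]; nlinarith
      · field_simp
        ring
  have hderiv : ∀ x ∈ Ioo (0:ℝ) m, HasDerivWithinAt ψ (-(s * m) / x ^ 2) (Ioo 0 m) x := by
    intro x hx
    have hx0 : x ≠ 0 := hx.1.ne'
    have h1 : HasDerivAt (fun x : ℝ => s * (m - x)) (s * (0 - 1)) x :=
      ((hasDerivAt_const x m).sub (hasDerivAt_id x)).const_mul s
    have h2 := h1.div (hasDerivAt_id x) hx0
    have h3 : HasDerivAt ψ (-(s * m) / x ^ 2) x :=
      h2.congr_deriv (by simp only [id_eq]; ring)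
    exact h3.hasDerivWithinAt
  have hinj : InjOn ψ (Ioo 0 m) := by
    intro x hx y hy hxy
    simp only [hψ] at hxy
    have hx0 : x ≠ 0 := hx.1.ne'
    have hy0 : y ≠ 0 := hy.1.ne'
    rw [div_eq_div_iff hx0 hy0] at hxy
    have h3 : s * m * y = s * m * x := by linear_combination hxy
    exact (mul_left_cancel₀ (mul_pos hs hm).ne' h3).symm
  have hcv := lintegral_image_eq_lintegral_abs_deriv_mul measurableSet_Ioo hderiv hinj
    (({t : ℝ | m * s / (s + t) ∈ E}).indicator (gammaPDF p 1))
  rw [himage] at hcv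
  rw [hcv]
  refine setLIntegral_congr_fun measurableSet_Ioo fun x hx => ?_
  have hx0 : x ≠ 0 := hx.1.ne'
  have hback : m * s / (s + ψ x) = x := by
    have h1 : s + ψ x = s * m / x := by
      simp only [hψ]; field_simp; ring
    rw [h1, div_div_eq_mul_div]
    field_simp
  have habs : |(-(s * m) / x ^ 2)| = s * m / x ^ 2 := by
    rw [abs_div, abs_neg, abs_of_pos (mul_pos hs hm), abs_of_pos (pow_pos hx.1 2)]
  rw [habs]
  by_cases hxE : x ∈ E
  · rw [Set.indicator_of_mem (show ψ x ∈ {t : ℝ | m * s / (s + t) ∈ E} by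
      simp only [Set.mem_setOf_eq]; rw [hback]; exact hxE), Set.indicator_of_mem hxE]
    simp only [Pi.one_apply, one_mul, hψ]
    ring
  · rw [Set.indicator_of_notMem (show ψ x ∉ {t : ℝ | m * s / (s + t) ∈ E} by
      simp only [Set.mem_setOf_eq]; rw [hback]; exact hxE), Set.indicator_of_notMem hxE]
    simp

/-- The density of `m S₁/(S₁+S₂)` on `(0,m)`, as an `s`-integral:
`q(x) = ∫_{(0,∞)} gammaPDF n 1 (s) · gammaPDF p 1 (s(m−x)/x) · (s m/x²) ds`. [folklore] -/
noncomputable def ratioDensity (n p m : ℝ) (x : ℝ) : ℝ≥0∞ :=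
  ∫⁻ s in Ioi (0:ℝ), gammaPDF n 1 s * (gammaPDF p 1 (s * (m - x) / x) * ENNReal.ofReal (s * m / x ^ 2))

/-- Joint measurability of the integrand of `ratioDensity`. [folklore] -/
theorem measurable_ratioIntegrand (n p m : ℝ) :
    Measurable (Function.uncurry fun (s x : ℝ) =>
      gammaPDF n 1 s * (gammaPDF p 1 (s * (m - x) / x) * ENNReal.ofReal (s * m / x ^ 2))) := by
  refine ((measurable_gammaPDF n 1).comp measurable_fst).mul
    (((measurable_gammaPDF p 1).comp ?_).mul (ENNReal.measurable_ofReal.comp ?_))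
  · exact (measurable_fst.mul (measurable_const.sub measurable_snd)).div measurable_snd
  · exact (measurable_fst.mul measurable_const).div (measurable_snd.pow_const 2)

/-- `ratioDensity n p m` is measurable. [folklore] -/
theorem measurable_ratioDensity (n p m : ℝ) : Measurable (ratioDensity n p m) := by
  unfold ratioDensity
  exact (measurable_ratioIntegrand n p m).lintegral_prod_left

/-- **Law of the ratio on sets**: for measurable `E`,
`(Gamma(n,1) ⊗ Gamma(p,1)){(s,t) | m s/(s+t) ∈ E} = ∫_{(0,m)} 1_E(x) q(x) dx`. [folklore] -/
theorem map_ratio_apply {n p m : ℝ} (hp : 0 < p) (hm : 0 < m) {E : Set ℝ}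
    (hE : MeasurableSet E) :
    ((gammaMeasure n 1).prod (gammaMeasure p 1)).map (fun q : ℝ × ℝ => m * q.1 / (q.1 + q.2)) E =
      ∫⁻ x in Ioo 0 m, E.indicator 1 x * ratioDensity n p m x := by
  haveI := isProbabilityMeasure_gammaMeasure hp one_pos
  have hF : Measurable fun q : ℝ × ℝ => m * q.1 / (q.1 + q.2) := by fun_prop
  rw [Measure.map_apply hF hE, Measure.prod_apply (hF hE)]
  have hsec : ∀ s, Prod.mk s ⁻¹' ((fun q : ℝ × ℝ => m * q.1 / (q.1 + q.2)) ⁻¹' E) =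
      {t | m * s / (s + t) ∈ E} := fun s => rfl
  simp_rw [hsec]
  have hmeasφ : Measurable fun s => gammaMeasure p 1 {t | m * s / (s + t) ∈ E} := by
    have := measurable_measure_prodMk_left (ν := gammaMeasure p 1) (hF hE)
    simp_rw [hsec] at this
    exact this
  have hstep : ∫⁻ s, gammaMeasure p 1 {t | m * s / (s + t) ∈ E} ∂(gammaMeasure n 1) =
      ∫⁻ s, gammaPDF n 1 s * gammaMeasure p 1 {t | m * s / (s + t) ∈ E} := by
    rw [gammaMeasure, lintegral_withDensity_eq_lintegral_mul _ (measurable_gammaPDF n 1) hmeasφ]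
    rfl
  rw [hstep, lintegral_gammaPDF_mul_eq_setLIntegral_Ioi,
    setLIntegral_congr_fun measurableSet_Ioi (fun s (hs : 0 < s) => by
      rw [gammaMeasure_preimage_ratio p hm hs hE])]
  -- the joint integrand
  have hGm : Measurable (Function.uncurry fun (s x : ℝ) => E.indicator 1 x *
      (gammaPDF p 1 (s * (m - x) / x) * ENNReal.ofReal (s * m / x ^ 2))) := by
    refine ((measurable_one.indicator hE).comp measurable_snd).mul
      (((measurable_gammaPDF p 1).comp ?_).mul (ENNReal.measurable_ofReal.comp ?_))
    · exact (measurable_fst.mul (measurable_const.sub measurable_snd)).div measurable_snd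
    · exact (measurable_fst.mul measurable_const).div (measurable_snd.pow_const 2)
  have hHm : Measurable (Function.uncurry fun (s x : ℝ) => gammaPDF n 1 s * (E.indicator 1 x *
      (gammaPDF p 1 (s * (m - x) / x) * ENNReal.ofReal (s * m / x ^ 2)))) :=
    ((measurable_gammaPDF n 1).comp measurable_fst).mul hGm
  have h1 : ∀ s, gammaPDF n 1 s * ∫⁻ x in Ioo 0 m, E.indicator 1 x *
      (gammaPDF p 1 (s * (m - x) / x) * ENNReal.ofReal (s * m / x ^ 2)) =
      ∫⁻ x in Ioo 0 m, gammaPDF n 1 s * (E.indicator 1 x *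
        (gammaPDF p 1 (s * (m - x) / x) * ENNReal.ofReal (s * m / x ^ 2))) := by
    intro s
    rw [← lintegral_const_mul]
    exact hGm.of_uncurry_left
  simp_rw [h1]
  rw [lintegral_lintegral_swap (hHm.aemeasurable)]
  refine setLIntegral_congr_fun measurableSet_Ioo fun x _ => ?_
  have h2 : ∀ s, gammaPDF n 1 s * (E.indicator 1 x *
      (gammaPDF p 1 (s * (m - x) / x) * ENNReal.ofReal (s * m / x ^ 2))) =
      E.indicator 1 x * (gammaPDF n 1 s *
        (gammaPDF p 1 (s * (m - x) / x) * ENNReal.ofReal (s * m / x ^ 2))) := fun s => by ring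
  simp_rw [h2]
  rw [lintegral_const_mul _ (measurable_ratioIntegrand n p m).of_uncurry_right]
  rfl

/-- **Closed form of the density** on `(0, m)` for integer shapes `n, p ≥ 1`:
`q(x) = Γ(n+p)/(Γ(n)Γ(p)) · x^{n−1}(m−x)^{p−1}/m^{n+p−1}`. [folklore] -/
theorem ratioDensity_eq {n p m : ℕ} (hn : 1 ≤ n) (hp : 1 ≤ p) {x : ℝ} (hx : x ∈ Ioo (0:ℝ) m) :
    ratioDensity n p m x = ENNReal.ofReal (Real.Gamma (n + p) / (Real.Gamma n * Real.Gamma p) *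
      (x ^ (n - 1) * ((m:ℝ) - x) ^ (p - 1) / (m:ℝ) ^ (n + p - 1))) := by
  obtain ⟨n', rfl⟩ : ∃ n', n = n' + 1 := ⟨n - 1, by omega⟩
  obtain ⟨p', rfl⟩ : ∃ p', p = p' + 1 := ⟨p - 1, by omega⟩
  have hx0 : 0 < x := hx.1
  have hxm : x < m := hx.2
  have hm : (0:ℝ) < m := by linarith
  set c : ℝ := ((m:ℝ) - x) / x with hc
  have hcpos : 0 < c := div_pos (by linarith) hx0
  have hΓn := Real.Gamma_pos_of_pos (by positivity : (0:ℝ) < (n' + 1 : ℕ))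
  have hΓp := Real.Gamma_pos_of_pos (by positivity : (0:ℝ) < (p' + 1 : ℕ))
  -- the integrand as one `ofReal`
  set K : ℝ := (m:ℝ) * c ^ p' / (x ^ 2 * (Real.Gamma (n' + 1 : ℕ) * Real.Gamma (p' + 1 : ℕ))) with hK
  have hK0 : 0 ≤ K := by positivity
  have hint : ∀ s ∈ Ioi (0:ℝ), gammaPDF (n' + 1 : ℕ) 1 s *
      (gammaPDF (p' + 1 : ℕ) 1 (s * ((m:ℝ) - x) / x) * ENNReal.ofReal (s * m / x ^ 2)) =
      ENNReal.ofReal K * ENNReal.ofReal (s ^ (n' + p' + 1) * (Real.exp (-s) * Real.exp (-(s * c)))) := by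
    intro s hs
    have hs' : (0:ℝ) < s := hs
    have hsc : 0 ≤ s * ((m:ℝ) - x) / x := by positivity
    rw [gammaPDF_natCast (by omega) hs'.le, gammaPDF_natCast (by omega) hsc,
      ← ENNReal.ofReal_mul (by positivity), ← ENNReal.ofReal_mul (by positivity),
      ← ENNReal.ofReal_mul hK0]
    congr 1
    simp only [Nat.add_sub_cancel]
    have hsx : s * ((m:ℝ) - x) / x = s * c := by rw [hc]; ring
    rw [hsx, mul_pow, hK]
    have hx2 : x ^ 2 ≠ 0 := by positivity
    field_simp
    ring
  have he : ∀ s : ℝ, Real.exp (-s) * Real.exp (-(s * c)) = Real.exp (-((1 + c) * s)) := by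
    intro s; rw [← Real.exp_add]; congr 1; ring
  simp_rw [he] at hint
  have h1c : 1 + c = (m:ℝ) / x := by rw [hc]; field_simp; ring
  have h1cpos : 0 < 1 + c := by linarith
  rw [ratioDensity, setLIntegral_congr_fun measurableSet_Ioi hint,
    lintegral_const_mul _ (by fun_prop), lintegral_Ioi_pow_mul_exp_neg_mul _ h1cpos,
    ← ENNReal.ofReal_mul hK0]
  congr 1
  -- real algebra
  have hΓeq : Real.Gamma (((n' + p' + 1 : ℕ) : ℝ) + 1) =
      Real.Gamma (((n' + 1 : ℕ) : ℝ) + ((p' + 1 : ℕ) : ℝ)) := by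
    congr 1; push_cast; ring
  rw [hΓeq, h1c, hK, hc]
  simp only [Nat.add_sub_cancel, show n' + 1 + (p' + 1) - 1 = n' + p' + 1 by omega]
  have hxn : x ≠ 0 := hx0.ne'
  have hmn : (m:ℝ) ≠ 0 := hm.ne'
  rw [div_pow, div_pow]
  field_simp
  ring

end Density

end Literature.Probability.Distributions
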